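import Summits.SmoothPoincare4.SmoothPoincare4.Theorems.SymplecticOrigamiOrigamiFoldExistenceStubOuterCleanRecognitionChartSide

/-!
# Stub `stub_outerCleanRecognitionOfSide` of line `shadow-pleats` for crux `OrigamiFoldExistence` — P2:
# the exterior of the chimney minus a closed cut collar is CONNECTED (item stmt-SmoothPoincare4-7844, route SymplecticOrigami; seat c4, wave 1)

For a `1`-chart pleated position `(ι, δ, e)` with collar data `cd : CollarData D` of its lifted
outer crease (chart shadow `G = proj5 ∘ ι ∘ e 0`, lift `λ = liftS4`, collar width `κ = cd.h.κ`)
and a cut radius `2 < R < 2 + κ`: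

* `isConnected_exterior_diff_cutCollar` — `exterior D ∖ λG({2 < ‖u‖ ≤ R})` is connected.

Pure point-set topology (`isPreconnected_diff_of_openCollar`): the lifted OPEN collar
`C⁺ = λG({2 < ‖u‖ < 2 + κ}) ⊆ exterior D` is open in `S⁴` (inverse function theorem for `G` on
the collar, `isOpen_image_of_injOn_fderiv`, and `λ` is an open map, `isOpenMap_liftS4`); it is
the cut collar plus the remainder `λG({R < ‖u‖ < 2 + κ})`, a non-empty preconnected subset of
`exterior D ∖ (cut collar)` (collar injectivity `cd.injOn`); and `exterior D ∖ (cut collar)` is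
open (the lifted CLOSED collar `λG({2 ≤ ‖u‖ ≤ R})` is compact and meets the exterior in the cut
collar, the crease being disjoint from the exterior).  A separation of `exterior D ∖ (cut collar)`
would then separate the connected `exterior D`.
-/

noncomputable section

set_option linter.dupNamespace false

open scoped Manifold ContDiff Topology RealInnerProductSpace
open Set Function Filter Metric
open Literature.Topology.FourManifolds Literature.Topology.FourManifolds.SphereHypersurfaceSides

namespace Summit.SmoothPoincare4.SmoothPoincare4.Theorems.OrigamiFoldExistence.ShadowPleats

/-! ### Point-set core: cutting a collar out of a connected open set -/

/-- **Point-set core.**  Let `X` be preconnected and `C ⊆ X` ("the cut collar") be contained in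
an OPEN set `C⁺` ("the open collar") with `C⁺ ⊆ C ∪ P`, where the "remainder" `P` is a
non-empty preconnected subset of `X ∖ C`, and assume `X ∖ C` is open.  Then `X ∖ C` is
preconnected: if `X ∖ C ⊆ u ∪ v` were a separation, `P` lies in one piece, say `u`, and then
`(X ∖ C) ∩ v` and `((X ∖ C) ∩ u) ∪ C⁺` would separate `X`. -/
theorem isPreconnected_diff_of_openCollar {α : Type*} [TopologicalSpace α] {X C Cp P : Set α}
    (hX : IsPreconnected X) (hE : IsOpen (X \ C)) (hCp : IsOpen Cp) (hC : C ⊆ Cp)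
    (hsplit : Cp ⊆ C ∪ P) (hP : IsPreconnected P) (hPE : P ⊆ X \ C) (hPne : P.Nonempty) :
    IsPreconnected (X \ C) := by
  -- half of the argument: if `P ⊆ u` then `X ∖ C` cannot meet `v`
  have key : ∀ u v : Set α, IsOpen u → IsOpen v → X \ C ⊆ u ∪ v → (X \ C) ∩ (u ∩ v) = ∅ →
      ((X \ C) ∩ v).Nonempty → ¬ P ⊆ u := by
    intro u v hu hv huv hdisj hv' hPu
    obtain ⟨p, hp⟩ := hPne
    obtain ⟨b, hb⟩ := hv'
    have hcover : X ⊆ ((X \ C) ∩ v) ∪ (((X \ C) ∩ u) ∪ Cp) := by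
      intro x hx
      by_cases hxC : x ∈ C
      · exact Or.inr (Or.inr (hC hxC))
      · rcases huv ⟨hx, hxC⟩ with h | h
        · exact Or.inr (Or.inl ⟨⟨hx, hxC⟩, h⟩)
        · exact Or.inl ⟨⟨hx, hxC⟩, h⟩
    obtain ⟨x, -, hxS, hxT⟩ := hX _ _ (hE.inter hv) ((hE.inter hu).union hCp) hcover
      ⟨b, hb.1.1, hb⟩ ⟨p, (hPE hp).1, Or.inl ⟨hPE hp, hPu hp⟩⟩
    have hxu : x ∈ u := by
      rcases hxT with h | h
      · exact h.2
      · rcases hsplit h with h' | h'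
        · exact absurd h' hxS.1.2
        · exact hPu h'
    have hx : x ∈ (X \ C) ∩ (u ∩ v) := ⟨hxS.1, hxu, hxS.2⟩
    rw [hdisj] at hx
    exact hx
  intro u v hu hv huv hu' hv'
  by_contra hne
  have hdisj : (X \ C) ∩ (u ∩ v) = ∅ := Set.not_nonempty_iff_eq_empty.1 hne
  have hPuv : P ∩ (u ∩ v) = ∅ := by
    rw [← Set.subset_empty_iff, ← hdisj]
    exact Set.inter_subset_inter_left _ hPE
  rcases isPreconnected_iff_subset_of_disjoint.1 hP u v hu hv (hPE.trans huv) hPuv with h | h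
  · exact key u v hu hv huv hdisj hv' h
  · exact key v u hv hu (by rwa [Set.union_comm]) (by rwa [Set.inter_comm v u]) hu' h

/-- The lift `λ = σ_N⁻¹` is an open map (`σ_N` is an open partial homeomorphism of `S⁴ ∖ {N}`
onto `ℝ⁴`). -/
theorem isOpenMap_liftS4 : IsOpenMap liftS4 := fun t ht =>
  (stereographic' 4 northPole).isOpen_image_symm_of_subset_target ht
    (by rw [stereographic'_target]; exact subset_univ _)

variable {M : Type} [TopologicalSpace M] [ChartedSpace (EuclideanSpace ℝ (Fin 4)) M]
  {ι : M → EuclideanSpace ℝ (Fin 5)} {δ : ℝ} {e : Fin 1 → EuclideanSpace ℝ (Fin 4) → M}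
  {D : TubeData (liftedCrease ι (e 0))}

/-- **The exterior of the chimney minus a closed cut collar is connected.** -/
theorem isConnected_exterior_diff_cutCollar (h : IsPleatedPosition ι δ e) (cd : CollarData D)
    {R : ℝ} (hR2 : 2 < R) (hRκ : R < 2 + cd.h.κ) :
    IsConnected (exterior D \ (liftS4 ∘ proj5 ∘ ι ∘ e 0) '' {u | 2 < ‖u‖ ∧ ‖u‖ ≤ R}) := by
  set G := proj5 ∘ ι ∘ e 0
  have hG : ContDiff ℝ ∞ G := contDiff_chartShadow h
  have hN : northPole ∉ range (liftedCrease ι (e 0)) := northPole_notMem_range_liftedCrease ι (e 0)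
  have hLG : Continuous (liftS4 ∘ G) := contMDiff_liftS4.continuous.comp hG.continuous
  -- non-empty: the north pole is exterior and off the range of the lift
  refine ⟨⟨northPole, northPole_mem_exterior D hN, ?_⟩, ?_⟩
  · rintro ⟨u, -, hu⟩
    exact liftS4_ne_northPole _ hu
  -- the cut collar `A`, the open collar `Ω ⊇ A` and the remainder shell `W`
  set A : Set (EuclideanSpace ℝ (Fin 4)) := {u | 2 < ‖u‖ ∧ ‖u‖ ≤ R}
  set Ω : Set (EuclideanSpace ℝ (Fin 4)) := {u | 2 < ‖u‖ ∧ ‖u‖ < 2 + cd.h.κ}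
  set W : Set (EuclideanSpace ℝ (Fin 4)) := {u | R < ‖u‖ ∧ ‖u‖ < 2 + cd.h.κ}
  have hΩo : IsOpen Ω :=
    (isOpen_lt continuous_const continuous_norm).inter (isOpen_lt continuous_norm continuous_const)
  -- `exterior ∖ λG(A)` is open: `λG({2 ≤ ‖u‖ ≤ R})` is compact and meets the exterior in `λG(A)`
  have hKc : IsCompact ((liftS4 ∘ G) '' {u | 2 ≤ ‖u‖ ∧ ‖u‖ ≤ R}) :=
    ((isCompact_closedBall (0 : EuclideanSpace ℝ (Fin 4)) R).of_isClosed_subset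
      ((isClosed_le continuous_const continuous_norm).inter (isClosed_le continuous_norm continuous_const))
      fun u hu => mem_closedBall_zero_iff.2 hu.2).image hLG
  have hCK : (liftS4 ∘ G) '' A ⊆ (liftS4 ∘ G) '' {u | 2 ≤ ‖u‖ ∧ ‖u‖ ≤ R} :=
    image_mono fun u hu => ⟨hu.1.le, hu.2⟩
  have hEeq : exterior D \ (liftS4 ∘ G) '' A = exterior D \ (liftS4 ∘ G) '' {u | 2 ≤ ‖u‖ ∧ ‖u‖ ≤ R} := by
    refine Subset.antisymm (fun z hz => ⟨hz.1, ?_⟩) fun z hz => ⟨hz.1, fun hzC => hz.2 (hCK hzC)⟩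
    rintro ⟨u, hu, hzu⟩
    rcases hu.1.lt_or_eq with hlt | heq
    · exact hz.2 ⟨u, ⟨hlt, hu.2⟩, hzu⟩
    · refine Set.disjoint_left.1 (disjoint_exterior_range D hN) hz.1 ?_
      rw [range_liftedCrease, ← hzu]
      exact ⟨u, mem_sphere_zero_iff_norm.2 heq.symm, rfl⟩
  have hEo : IsOpen (exterior D \ (liftS4 ∘ G) '' A) := by
    rw [hEeq]
    exact (isOpen_exterior D hN).sdiff hKc.isClosed
  -- the lifted open collar is open (inverse function theorem for `G`; `λ` is an open map)
  have hCpo : IsOpen ((liftS4 ∘ G) '' Ω) := by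
    rw [image_comp]
    exact isOpenMap_liftS4 _ (isOpen_image_of_injOn_fderiv hG.contDiffOn hΩo
      (fun x hx => cd.immersive x hx.1 hx.2) hΩo Subset.rfl)
  refine isPreconnected_diff_of_openCollar (Cp := (liftS4 ∘ G) '' Ω) (P := (liftS4 ∘ G) '' W)
    (isConnected_exterior D hN).isPreconnected hEo hCpo
    (image_mono fun u hu => ⟨hu.1, hu.2.trans_lt hRκ⟩) ?_
    ((isPreconnected_openShell (b := 2 + cd.h.κ) (by linarith)).image _ hLG.continuousOn) ?_ ?_
  · -- a point of the open collar is cut (`‖u‖ ≤ R`) or remains (`R < ‖u‖`)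
    rintro _ ⟨w, hw, rfl⟩
    rcases le_or_gt ‖w‖ R with hle | hlt
    · exact Or.inl ⟨w, ⟨hw.1, hle⟩, rfl⟩
    · exact Or.inr ⟨w, ⟨hlt, hw.2⟩, rfl⟩
  · -- the remainder is exterior (collar data) and misses the cut collar (collar injectivity)
    rintro _ ⟨w, hw, rfl⟩
    refine ⟨cd.mem_exterior w (hR2.trans hw.1) hw.2, ?_⟩
    rintro ⟨u, hu, huw⟩
    have huw' : liftS4 (G u) = liftS4 (G w) := huw
    have heq : u = w :=
      cd.injOn ⟨hu.1.le, hu.2.trans_lt hRκ⟩ ⟨(hR2.trans hw.1).le, hw.2⟩ (liftS4_injective huw')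
    rw [heq] at hu
    exact lt_irrefl _ (hu.2.trans_lt hw.1)
  · -- the remainder is non-empty (`R < 2 + κ`)
    obtain ⟨r, hRr, hrκ⟩ : ∃ r : ℝ, R < r ∧ r < 2 + cd.h.κ := ⟨(R + (2 + cd.h.κ)) / 2, by linarith, by linarith⟩
    have hr0 : 0 ≤ r := by linarith
    have hnw : ‖(EuclideanSpace.single (0 : Fin 4) r : EuclideanSpace ℝ (Fin 4))‖ = r := by
      simp [abs_of_nonneg hr0]
    exact ⟨_, ⟨EuclideanSpace.single (0 : Fin 4) r, ⟨by rw [hnw]; exact hRr, by rw [hnw]; exact hrκ⟩, rfl⟩⟩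

end Summit.SmoothPoincare4.SmoothPoincare4.Theorems.OrigamiFoldExistence.ShadowPleats

end
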